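import Summits.QuantumFields.YangMills.Theorems.BalabanUVNodesN19TiltedPrice
import Mathlib.Analysis.SpecialFunctions.Trigonometric.InverseDeriv

/-!
# YM-DAG node N19 (= NE7 proper) — THE TILTED PRICE ALONG THE WINDOW, I: linear SOMEWHERE in every sub-window; the VARIATION from above

Cell `pub-ymgap`, HUMAN RULING D-0062 (Track A), R141 (C) wider-strategy seat `pub-ymgap-dag-n19-e` (strategy s3 = ALTERNATIVE CURRENCY), generation
g17, module 2 (sibling to follow: `…N19TiltedPriceVariationTwoSided` — the variation from BELOW along p510514's grid-Chebyshev pair, and the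
two-sided statement).  Route `Summits/QuantumFields/YangMills/Theses/BalabanUVNodes.lean` rev 25, cluster item K3⁷ «SpineGivenEndpointR13SepCoPH»
(stmt-QuantumFields-20544, dag-lead WORDS-143); filed `--supports` that item `--as helper` (it proves no registered stub).  COUNT-NEUTRAL: elementary real analysis over Mathlib (mean value theorem
`exists_hasDerivAt_eq_slope`, `monotoneOn_of_deriv_nonneg`, `Real.hasDerivAt_arcsin`, `analyticAt_cgf` ∕ `integral_tilted_mul_self`) + the seat's
p528923 `…N19TiltedPrice.abs_tiltedMean_sub_le_sharp_of_cgf_close` BY NAME; no scheme object, no Theses import; NOT a discharge claim.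

THE QUESTION (the seat's HANDOFF v13, «STILL OPEN: UNIFORMITY in `s` of the interior witness»).  g15∕g16 priced the source-tilted means of two
laws whose cgf's are `ε`-close (mod a constant) on `|u| ≤ l₀`: at an interior source `s` the difference is at most Bernstein's
`C(l₀,B)·P(ε)∕√(l₀² − s²)`, `P(ε) = ε(1+L)∕log(e+L)`, `L = log⁺ε⁻¹` (p528923), and for EACH `s` some pair attains `c(l₀)·P(ε)∕√(l₀² − s²)` (p539220) —
a different pair for each source (the detuned grid-Chebyshev weights are extremal near ONE source).  Can ONE pair be extremal along a whole sub-window?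

THE ANSWER (§1): NO, for a one-line reason — ★ `exists_abs_tiltedMean_sub_le_of_cgf_close`: the difference of the tilted means is the DERIVATIVE of
`u ↦ cgf F′ ν′ u − cgf F ν u` (Mathlib `integral_tilted_mul_self`), whose increment over any `[a, b] ⊆ [−l₀, l₀]` is at most `2ε`; by the mean value
theorem every sub-window holds a source `ξ` where the tilted means are `2ε∕(b − a)`-close — a LINEAR price somewhere in every sub-window, for EVERY pair.
So the super-linear interior price is a pointwise supremum that no pair realises uniformly; HANDOFF v13's «a Bernstein-uniform lower bound, if true, needs a
different witness family» is settled as «false for every family».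

THE VARIATION (§2).  What survives uniformly is the TOTAL VARIATION of the cgf difference along the window: ★ `sum_abs_cgf_increments_le` — for every
monotone family of sources `−l₀ ≤ t_0 ≤ … ≤ t_m ≤ l₀` (closed window),
`∑_{i<m} |Δ(t_{i+1}) − Δ(t_i)| ≤ K·(arcsin(t_m∕l₀) − arcsin(t_0∕l₀)) ≤ π·K`, `K = 8e^{1+2e·l₀B}·ε(1+L₂)∕log(e+L₂)`, `L₂ = log⁺(2ε)⁻¹`
(Bernstein's weight `1∕√(l₀² − s²)` is `(arcsin(s∕l₀))′`; §2's comparison lemma `abs_sub_le_sub_of_abs_deriv_le` needs the derivative bound only INSIDE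
each `[t_i, t_{i+1}]` and continuity at the ends, so the closed window is allowed; the `arcsin` increments telescope).  The sibling shows this is the
truth: p510514's pair has `≍ M ≍ (1+L)∕log(e+L)` sign ALTERNATIONS of size `ε` along `[0, l₀]` (Chebyshev's equioscillation), so the variation price is
`P(ε)` TWO-SIDED — the expectation price, not Bernstein's and not Markov's, governs the window in the mean.

HONEST FRAMING (binding).  Elementary and [folklore] (MVT; Bernstein integrates to `arcsin`); NO consumer in the DAG today (value: closes the seat's
open item (i) and prices the window «in the mean»; N14's binder `TiltedMeanMatching` is served already by p531657∕p533044).  Nothing of Bałaban's is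
instantiated; NE7 ∕ NE7b ∕ NE7c NOT PRINTED, NOT proved; N19 NOT discharged; count-neutral.  One finite `T⁴` programme at fixed `ε`; nothing continuum ∕
`ℝ⁴` ∕ OS ∕ mass-gap ∕ Clay.  0 `def` ∕ 0 `sorry`.
-/

noncomputable section

open Real Finset MeasureTheory ProbabilityTheory

namespace Summit.QuantumFields.YangMills.Theorems.BalabanUVNodesN19TiltedPriceVariation

open Literature.MathematicalPhysics.QuantumFieldTheory.Balaban1983to89
open Summit.QuantumFields.BalabanUV.T4Continuum.NE1p.DressedMGFForm (tiltedMean)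
open Summit.QuantumFields.YangMills.Theorems.BalabanUVNodesN19TiltedPrice (abs_tiltedMean_sub_le_sharp_of_cgf_close)

/-! ## §1 A LINEAR price somewhere in every sub-window [folklore] -/

section Somewhere

variable {Ω Ω' : Type*} {mΩ : MeasurableSpace Ω} {mΩ' : MeasurableSpace Ω'} {ν : Measure Ω} {ν' : Measure Ω'}
  [IsFiniteMeasure ν] [IsFiniteMeasure ν'] {F : Ω → ℝ} {F' : Ω' → ℝ} {B B' : ℝ}

/-- The cgf of an a.e.-bounded observable under a finite measure is differentiable at every real source, with derivative the
source-tilted mean (Mathlib `analyticAt_cgf` + `integral_tilted_mul_self`; every source is interior to `integrableExpSet`). [folklore] -/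
theorem hasDerivAt_cgf_tiltedMean (hFm : AEMeasurable F ν) (hF : ∀ᵐ ω ∂ν, |F ω| ≤ B) (u : ℝ) :
    HasDerivAt (cgf F ν) (tiltedMean F ν u) u := by
  have h1 := T4GenFunBounds.mem_interior_integrableExpSet hFm hF u
  have h := (analyticAt_cgf h1).differentiableAt.hasDerivAt
  rwa [← integral_tilted_mul_self h1] at h

/-- The difference of two such cgf's is differentiable everywhere, with derivative the difference of the tilted means. [folklore] -/
theorem hasDerivAt_cgf_sub (hFm : AEMeasurable F ν) (hF : ∀ᵐ ω ∂ν, |F ω| ≤ B)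
    (hFm' : AEMeasurable F' ν') (hF' : ∀ᵐ ω ∂ν', |F' ω| ≤ B') (u : ℝ) :
    HasDerivAt (fun u => cgf F' ν' u - cgf F ν u) (tiltedMean F' ν' u - tiltedMean F ν u) u :=
  (hasDerivAt_cgf_tiltedMean hFm' hF' u).sub (hasDerivAt_cgf_tiltedMean hFm hF u)

/-- **★ A LINEAR PRICE SOMEWHERE IN EVERY SUB-WINDOW.**  `ν`, `ν′` finite, `F`, `F′` a.e.-measurable and a.e.-bounded; if
`|cgf F′ ν′ u − cgf F ν u − c| ≤ ε` for `|u| ≤ l₀` (ONE constant `c`), then every sub-window `[a, b] ⊆ [−l₀, l₀]`, `a < b`, holds a source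
`ξ ∈ (a, b)` with `|tiltedMean F′ ν′ ξ − tiltedMean F ν ξ| ≤ 2ε∕(b − a)` — the mean value theorem for `u ↦ cgf F′ ν′ u − cgf F ν u`, whose
derivative is the difference of the tilted means and whose increment over `[a, b]` is at most `2ε`.  CONSEQUENCE (the seat's HANDOFF v13 open item
(i), «uniformity in `s` of the interior lower bound»): NO pair whatsoever has `|ΔtiltedMean(s)| ≥ ρ∕√(l₀² − s²)` for all `s` of a sub-window of
length `> 2ε∕ρ` — in particular no witness family is Bernstein-extremal `≍ P(ε)∕√(l₀²−s²)` (`P(ε)∕ε → ∞`) uniformly on any fixed sub-window; the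
interior price of p528923 ∕ p539220 is a pointwise-in-`s` supremum, attained near ONE source at a time. [folklore] -/
theorem exists_abs_tiltedMean_sub_le_of_cgf_close (hFm : AEMeasurable F ν) (hF : ∀ᵐ ω ∂ν, |F ω| ≤ B)
    (hFm' : AEMeasurable F' ν') (hF' : ∀ᵐ ω ∂ν', |F' ω| ≤ B') {c ε l₀ a b : ℝ}
    (hε : ∀ u : ℝ, |u| ≤ l₀ → |cgf F' ν' u - cgf F ν u - c| ≤ ε) (ha : -l₀ ≤ a) (hb : b ≤ l₀) (hab : a < b) :
    ∃ ξ ∈ Set.Ioo a b, |tiltedMean F' ν' ξ - tiltedMean F ν ξ| ≤ 2 * ε / (b - a) := by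
  have hd := hasDerivAt_cgf_sub hFm hF hFm' hF'
  obtain ⟨ξ, hξ, hslope⟩ := exists_hasDerivAt_eq_slope (fun u => cgf F' ν' u - cgf F ν u)
    (fun u => tiltedMean F' ν' u - tiltedMean F ν u) hab
    (fun x _ => (hd x).continuousAt.continuousWithinAt) (fun x _ => hd x)
  refine ⟨ξ, hξ, ?_⟩
  have hba : 0 < b - a := sub_pos.2 hab
  have hb' : |b| ≤ l₀ := abs_le.2 ⟨by linarith, hb⟩
  have ha' : |a| ≤ l₀ := abs_le.2 ⟨ha, by linarith⟩
  have hinc : |(cgf F' ν' b - cgf F ν b) - (cgf F' ν' a - cgf F ν a)| ≤ 2 * ε := by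
    have h1 := hε b hb'
    have h2 := hε a ha'
    calc |(cgf F' ν' b - cgf F ν b) - (cgf F' ν' a - cgf F ν a)|
        = |(cgf F' ν' b - cgf F ν b - c) - (cgf F' ν' a - cgf F ν a - c)| := by ring_nf
      _ ≤ |cgf F' ν' b - cgf F ν b - c| + |cgf F' ν' a - cgf F ν a - c| := abs_sub _ _
      _ ≤ 2 * ε := by linarith
  rw [hslope, abs_div, abs_of_pos hba]
  exact div_le_div_of_nonneg_right hinc hba.le

end Somewhere

/-! ## §2 The VARIATION of the cgf difference over the window: Bernstein's bound integrates to `arcsin` [folklore] -/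

/-- Comparison of increments [folklore]: `h`, `Φ` continuous on `[a, b]` and differentiable inside with `|h′| ≤ Φ′` there ⇒
`|h b − h a| ≤ Φ b − Φ a` (monotonicity of `Φ − h` and `Φ + h`, Mathlib `monotoneOn_of_deriv_nonneg`). -/
theorem abs_sub_le_sub_of_abs_deriv_le {h Φ h' Φ' : ℝ → ℝ} {a b : ℝ} (hab : a ≤ b)
    (hhc : ContinuousOn h (Set.Icc a b)) (hΦc : ContinuousOn Φ (Set.Icc a b))
    (hh : ∀ x ∈ Set.Ioo a b, HasDerivAt h (h' x) x) (hΦ : ∀ x ∈ Set.Ioo a b, HasDerivAt Φ (Φ' x) x)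
    (hle : ∀ x ∈ Set.Ioo a b, |h' x| ≤ Φ' x) : |h b - h a| ≤ Φ b - Φ a := by
  have hI : interior (Set.Icc a b) = Set.Ioo a b := interior_Icc
  have ha : a ∈ Set.Icc a b := Set.left_mem_Icc.2 hab
  have hb : b ∈ Set.Icc a b := Set.right_mem_Icc.2 hab
  have hdm : ∀ x ∈ Set.Ioo a b, HasDerivAt (fun y => Φ y - h y) (Φ' x - h' x) x :=
    fun x hx => (hΦ x hx).sub (hh x hx)
  have hdp : ∀ x ∈ Set.Ioo a b, HasDerivAt (fun y => Φ y + h y) (Φ' x + h' x) x :=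
    fun x hx => (hΦ x hx).add (hh x hx)
  have hm : MonotoneOn (fun x => Φ x - h x) (Set.Icc a b) := by
    refine monotoneOn_of_deriv_nonneg (convex_Icc a b) (hΦc.sub hhc) ?_ ?_
    · rw [hI]
      exact fun x hx => (hdm x hx).differentiableAt.differentiableWithinAt
    · rw [hI]
      intro x hx
      rw [(hdm x hx).deriv]
      linarith [hle x hx, le_abs_self (h' x)]
  have hp : MonotoneOn (fun x => Φ x + h x) (Set.Icc a b) := by
    refine monotoneOn_of_deriv_nonneg (convex_Icc a b) (hΦc.add hhc) ?_ ?_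
    · rw [hI]
      exact fun x hx => (hdp x hx).differentiableAt.differentiableWithinAt
    · rw [hI]
      intro x hx
      rw [(hdp x hx).deriv]
      linarith [hle x hx, neg_abs_le (h' x)]
  have h1 := hm ha hb hab
  have h2 := hp ha hb hab
  simp only at h1 h2
  rw [abs_le]
  constructor <;> linarith

/-- The antiderivative of Bernstein's weight: `s ↦ arcsin(s∕l₀)` has derivative `1∕√(l₀² − s²)` at every `|s| < l₀` (`0 < l₀`). [folklore] -/
theorem hasDerivAt_arcsin_div {l₀ s : ℝ} (hl₀ : 0 < l₀) (hs : |s| < l₀) :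
    HasDerivAt (fun s => arcsin (s / l₀)) (1 / Real.sqrt (l₀ ^ 2 - s ^ 2)) s := by
  obtain ⟨hs1, hs2⟩ := abs_lt.1 hs
  have hx1 : s / l₀ ≠ -1 := by
    intro h; have := (div_eq_iff hl₀.ne').1 h; linarith
  have hx2 : s / l₀ ≠ 1 := by
    intro h; have := (div_eq_iff hl₀.ne').1 h; linarith
  have h1 : HasDerivAt (fun s : ℝ => s / l₀) (1 / l₀) s := by
    simpa using (hasDerivAt_id s).div_const l₀
  have h2 : HasDerivAt (fun s : ℝ => arcsin (s / l₀)) (1 / Real.sqrt (1 - (s / l₀) ^ 2) * (1 / l₀)) s := by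
    have := (Real.hasDerivAt_arcsin hx1 hx2).comp s h1
    rwa [Function.comp_def] at this
  have hnn : 0 ≤ 1 - (s / l₀) ^ 2 := by
    rw [div_pow, sub_nonneg, div_le_one (by positivity)]
    nlinarith [abs_nonneg s, sq_abs s]
  have hsq : Real.sqrt (1 - (s / l₀) ^ 2) * l₀ = Real.sqrt (l₀ ^ 2 - s ^ 2) := by
    have e : l₀ ^ 2 - s ^ 2 = (1 - (s / l₀) ^ 2) * l₀ ^ 2 := by
      field_simp
    rw [e, Real.sqrt_mul hnn, Real.sqrt_sq hl₀.le]
  refine h2.congr_deriv ?_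
  rw [div_mul_div_comm, one_mul, hsq]

section Variation

variable {Ω Ω' : Type*} {mΩ : MeasurableSpace Ω} {mΩ' : MeasurableSpace Ω'} {ν : Measure Ω} {ν' : Measure Ω'}
  [IsFiniteMeasure ν] [IsFiniteMeasure ν'] {F : Ω → ℝ} {F' : Ω' → ℝ} {B : ℝ}

/-- **★ THE VARIATION PRICE FROM ABOVE: BERNSTEIN INTEGRATES TO `arcsin`.**  `ν`, `ν′` non-zero finite, `F`, `F′` a.e.-measurable with
`|F|, |F′| ≤ B` a.e.; if `|cgf F′ ν′ u − cgf F ν u − c| ≤ ε` for `|u| ≤ l₀` (`0 < l₀`, `0 ≤ ε`), then along EVERY monotone family of sources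
`−l₀ ≤ t_0 ≤ t_1 ≤ … ≤ t_m ≤ l₀` (the CLOSED window) the variation of `u ↦ cgf F′ ν′ u − cgf F ν u` obeys
`∑_{i<m} |Δ(t_{i+1}) − Δ(t_i)| ≤ K·(arcsin(t_m∕l₀) − arcsin(t_0∕l₀)) ≤ π·K`, `K = 8e^{1+2e·l₀B}·ε(1 + L₂)∕log(e + L₂)`, `L₂ = log⁺(2ε)⁻¹`:
p528923's pointwise Bernstein bound `|ΔtiltedMean(s)| ≤ 8e^{1+e(l₀+|s|)B}ε(1+L₂)∕(√(l₀²−s²)log(e+L₂))` (`|s| < l₀`) is the derivative bound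
`|Δ′| ≤ K∕√(l₀² − s²) = (K·arcsin(·∕l₀))′` inside each `[t_i, t_{i+1}]`, compared by §2's lemma (continuity at `±l₀` suffices at the ends), and the
`arcsin` increments telescope.  So the WINDOW-VARIATION price is at most `π·8e^{1+2e·l₀B}` times the expectation price `P(2ε)` — although
(§1) the pointwise price is linear somewhere in every sub-window. [folklore] -/
theorem sum_abs_cgf_increments_le [NeZero ν] [NeZero ν'] (hFm : AEMeasurable F ν) (hF : ∀ᵐ ω ∂ν, |F ω| ≤ B)
    (hFm' : AEMeasurable F' ν') (hF' : ∀ᵐ ω ∂ν', |F' ω| ≤ B) {c ε l₀ : ℝ} (hl₀ : 0 < l₀) (hε0 : 0 ≤ ε)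
    (hε : ∀ u : ℝ, |u| ≤ l₀ → |cgf F' ν' u - cgf F ν u - c| ≤ ε) {t : ℕ → ℝ} (ht : Monotone t) {m : ℕ}
    (h0 : -l₀ ≤ t 0) (hm : t m ≤ l₀) :
    ∑ i ∈ range m, |(cgf F' ν' (t (i + 1)) - cgf F ν (t (i + 1))) - (cgf F' ν' (t i) - cgf F ν (t i))| ≤
      8 * Real.exp (1 + 2 * Real.exp 1 * l₀ * B) * ε * (1 + Real.posLog (2 * ε)⁻¹) /
          Real.log (Real.exp 1 + Real.posLog (2 * ε)⁻¹) * (arcsin (t m / l₀) - arcsin (t 0 / l₀)) := by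
  have hB0 : 0 ≤ B := T4GenFunBounds.nonneg_of_ae_abs_le (NeZero.ne ν) hF
  set L₂ := Real.posLog (2 * ε)⁻¹ with hL₂
  have hL0 : 0 ≤ L₂ := Real.posLog_nonneg
  have hlog : 0 < Real.log (Real.exp 1 + L₂) := Real.log_pos (by linarith [Real.exp_one_gt_d9])
  set K := 8 * Real.exp (1 + 2 * Real.exp 1 * l₀ * B) * ε * (1 + L₂) / Real.log (Real.exp 1 + L₂) with hK
  have hK0 : 0 ≤ K := by positivity
  -- the derivative bound inside the window
  have hd := hasDerivAt_cgf_sub hFm hF hFm' hF'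
  have hbound : ∀ s : ℝ, |s| < l₀ → |tiltedMean F' ν' s - tiltedMean F ν s| ≤ K * (1 / Real.sqrt (l₀ ^ 2 - s ^ 2)) := by
    intro s hs
    have h := abs_tiltedMean_sub_le_sharp_of_cgf_close hFm hF hFm' hF' hε0 hε hs
    refine h.trans ?_
    have hsqrt : 0 < Real.sqrt (l₀ ^ 2 - s ^ 2) := Real.sqrt_pos.2 (by have := sq_abs s; nlinarith [abs_nonneg s])
    have hexp : Real.exp 1 * (l₀ + |s|) * B ≤ 2 * Real.exp 1 * l₀ * B := by
      nlinarith [mul_nonneg (mul_nonneg (Real.exp_pos 1).le hB0) (sub_nonneg.2 hs.le)]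
    calc 8 * Real.exp (1 + Real.exp 1 * (l₀ + |s|) * B) * ε * (1 + L₂) / (Real.sqrt (l₀ ^ 2 - s ^ 2) * Real.log (Real.exp 1 + L₂))
        = 8 * Real.exp (1 + Real.exp 1 * (l₀ + |s|) * B) * ε * (1 + L₂) / Real.log (Real.exp 1 + L₂) *
            (1 / Real.sqrt (l₀ ^ 2 - s ^ 2)) := by
          rw [mul_one_div, div_div, mul_comm (Real.log _)]
      _ ≤ K * (1 / Real.sqrt (l₀ ^ 2 - s ^ 2)) := by
          refine mul_le_mul_of_nonneg_right ?_ (by positivity)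
          rw [hK]
          gcongr
  -- each increment is dominated by the `arcsin` increment
  have hstep : ∀ a b : ℝ, -l₀ ≤ a → a ≤ b → b ≤ l₀ →
      |(cgf F' ν' b - cgf F ν b) - (cgf F' ν' a - cgf F ν a)| ≤ K * arcsin (b / l₀) - K * arcsin (a / l₀) := by
    intro a b ha hab hb
    refine abs_sub_le_sub_of_abs_deriv_le (h := fun u => cgf F' ν' u - cgf F ν u) (Φ := fun u => K * arcsin (u / l₀))
      (h' := fun u => tiltedMean F' ν' u - tiltedMean F ν u) (Φ' := fun u => K * (1 / Real.sqrt (l₀ ^ 2 - u ^ 2))) hab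
      (fun x _ => (hd x).continuousAt.continuousWithinAt)
      ((continuous_const.mul (Real.continuous_arcsin.comp (continuous_id.div_const l₀))).continuousOn)
      (fun x _ => hd x) (fun x hx => ?_) (fun x hx => ?_)
    · have hx : |x| < l₀ := abs_lt.2 ⟨by linarith [hx.1], by linarith [hx.2]⟩
      exact (hasDerivAt_arcsin_div hl₀ hx).const_mul K
    · have hx : |x| < l₀ := abs_lt.2 ⟨by linarith [hx.1], by linarith [hx.2]⟩
      exact hbound x hx
  -- telescope
  have hti : ∀ i, i ≤ m → -l₀ ≤ t i ∧ t i ≤ l₀ := fun i hi =>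
    ⟨h0.trans (ht (Nat.zero_le i)), (ht hi).trans hm⟩
  calc ∑ i ∈ range m, |(cgf F' ν' (t (i + 1)) - cgf F ν (t (i + 1))) - (cgf F' ν' (t i) - cgf F ν (t i))|
      ≤ ∑ i ∈ range m, (K * arcsin (t (i + 1) / l₀) - K * arcsin (t i / l₀)) := by
        refine sum_le_sum fun i hi => ?_
        have him : i + 1 ≤ m := mem_range.1 hi
        exact hstep _ _ (hti i (Nat.le_of_succ_le him)).1 (ht (Nat.le_succ i)) (hti (i + 1) him).2
    _ = K * arcsin (t m / l₀) - K * arcsin (t 0 / l₀) := sum_range_sub (fun i => K * arcsin (t i / l₀)) m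
    _ = K * (arcsin (t m / l₀) - arcsin (t 0 / l₀)) := by ring

/-- … hence `≤ π·K` along every monotone family in the closed window (`arcsin ∈ [−π∕2, π∕2]`). [folklore] -/
theorem sum_abs_cgf_increments_le_pi [NeZero ν] [NeZero ν'] (hFm : AEMeasurable F ν) (hF : ∀ᵐ ω ∂ν, |F ω| ≤ B)
    (hFm' : AEMeasurable F' ν') (hF' : ∀ᵐ ω ∂ν', |F' ω| ≤ B) {c ε l₀ : ℝ} (hl₀ : 0 < l₀) (hε0 : 0 ≤ ε)
    (hε : ∀ u : ℝ, |u| ≤ l₀ → |cgf F' ν' u - cgf F ν u - c| ≤ ε) {t : ℕ → ℝ} (ht : Monotone t) {m : ℕ}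
    (h0 : -l₀ ≤ t 0) (hm : t m ≤ l₀) :
    ∑ i ∈ range m, |(cgf F' ν' (t (i + 1)) - cgf F ν (t (i + 1))) - (cgf F' ν' (t i) - cgf F ν (t i))| ≤
      π * (8 * Real.exp (1 + 2 * Real.exp 1 * l₀ * B) * ε * (1 + Real.posLog (2 * ε)⁻¹) /
          Real.log (Real.exp 1 + Real.posLog (2 * ε)⁻¹)) := by
  have hB0 : 0 ≤ B := T4GenFunBounds.nonneg_of_ae_abs_le (NeZero.ne ν) hF
  have hlog : 0 < Real.log (Real.exp 1 + Real.posLog (2 * ε)⁻¹) :=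
    Real.log_pos (by linarith [Real.exp_one_gt_d9, Real.posLog_nonneg (x := (2 * ε)⁻¹)])
  refine (sum_abs_cgf_increments_le hFm hF hFm' hF' hl₀ hε0 hε ht h0 hm).trans ?_
  rw [mul_comm π]
  refine mul_le_mul_of_nonneg_left ?_
    (div_nonneg (mul_nonneg (mul_nonneg (by positivity) hε0) (add_nonneg zero_le_one Real.posLog_nonneg)) hlog.le)
  linarith [Real.arcsin_le_pi_div_two (t m / l₀), Real.neg_pi_div_two_le_arcsin (t 0 / l₀)]

end Variation

/-! ## §3 What one sign alternation costs the cgf difference [folklore] -/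

/-- One ALTERNATION costs the cgf difference an increment `≥ e∕max(A, A′)` [folklore]: positive numbers with `P − A = −σe`, `Q − A′ = σe`
(`σ = ±1`, `e ≥ 0`) have `|(log Q − log A′) − (log P − log A)| ≥ e∕max(A, A′)` (`log x ≤ x − 1` on the side that moves down; the other side
moves up). -/
theorem div_max_le_abs_log_increment {A A' P Q e σ : ℝ} (hA : 0 < A) (hA' : 0 < A') (hP : 0 < P) (hQ : 0 < Q) (he : 0 ≤ e)
    (hσ : σ = 1 ∨ σ = -1) (h1 : P - A = -σ * e) (h2 : Q - A' = σ * e) :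
    e / max A A' ≤ |(Real.log Q - Real.log A') - (Real.log P - Real.log A)| := by
  have hmax : 0 < max A A' := lt_max_of_lt_left hA
  rcases hσ with rfl | rfl
  · -- `P = A − e` moves down, `Q = A′ + e` moves up
    have hdown : Real.log P - Real.log A ≤ -(e / A) := by
      rw [← Real.log_div hP.ne' hA.ne']
      have := Real.log_le_sub_one_of_pos (div_pos hP hA)
      have e1 : P / A - 1 = -(e / A) := by field_simp; linarith
      linarith
    have hup : 0 ≤ Real.log Q - Real.log A' := by
      rw [sub_nonneg]; exact Real.log_le_log hA' (by linarith)
    have heA : 0 ≤ e / A := div_nonneg he hA.le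
    calc e / max A A' ≤ e / A := div_le_div_of_nonneg_left he hA (le_max_left _ _)
      _ ≤ |(Real.log Q - Real.log A') - (Real.log P - Real.log A)| := by
          rw [abs_of_nonneg (by linarith)]; linarith
  · -- `P = A + e` moves up, `Q = A′ − e` moves down
    have hdown : Real.log Q - Real.log A' ≤ -(e / A') := by
      rw [← Real.log_div hQ.ne' hA'.ne']
      have := Real.log_le_sub_one_of_pos (div_pos hQ hA')
      have e1 : Q / A' - 1 = -(e / A') := by field_simp; linarith
      linarith
    have hup : 0 ≤ Real.log P - Real.log A := by
      rw [sub_nonneg]; exact Real.log_le_log hA (by linarith)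
    have heA : 0 ≤ e / A' := div_nonneg he hA'.le
    calc e / max A A' ≤ e / A' := div_le_div_of_nonneg_left he hA' (le_max_right _ _)
      _ ≤ |(Real.log Q - Real.log A') - (Real.log P - Real.log A)| := by
          rw [abs_of_nonpos (by linarith)]; linarith

end Summit.QuantumFields.YangMills.Theorems.BalabanUVNodesN19TiltedPriceVariation

end
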